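import Mathlib.Data.Fintype.Vector
import Literature.Computability.Complexity.BoolEncodings
import Literature.Computability.Complexity.Classes
import Literature.Computability.Complexity.Nondeterministic
import Literature.Computability.Complexity.ProbabilisticClasses
import Literature.Computability.Complexity.Oracle
import HarnessLib

-- provenance: harness21/H21/H21/Prelude/CplxCore/Counting.lean @ 7b57685 (interim HEAD d8f2665); M5 mechanical rewrite
/-!
# Complexity core: counting classes `#P`, `GapP`, `P^{#P}`, `#P`-hardness

Trunk `CplxCore`, concept C11 (`Counting`; realises the `#P` half of the notion
`class_PP_sharpP`). All classes live over bit strings `List Bool` with the fixed pairing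
`boolPair` (outline D3/D7):

* `countWitnesses R m x` — the number of strings `y ∈ {0,1}^m` with `boolPair x y ∈ R`;
* `SharpP` — Valiant's `#P`: functions `x ↦ countWitnesses R (p |x|) x` with `R ∈ P`;
* `GapP` — Fenner–Fortnow–Kurtz: differences of two `#P` functions;
* `PSharpP = P^{#P}`, `FPSharpP = FP^{#P}` (via the function oracle `Oracle.ofFun f`);
* relativised `PPRel O = PP^O := pMajority (P^O)` and `SharpPRel O = #P^O`;
* `IsSharpPHard O` (every `#P` function is in `FP^O`), `IsSharpPHardFun f`.

API (proofs `sorry` where they need machine constructions): `mem_PP_iff_gapP`,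
`NP_subset_PSharpP`, `PP_subset_PSharpP`, `sharpP_mem_FPSharpP`, plus the easy
`SharpP_subset_GapP`, `PPRel_mono`-style unfoldings. Toda's theorem is NOT stated here.

Mathlib has no counting complexity classes (searched `SharpP`, `#P`, `GapP`, `Valiant`,
`permanent` complexity: nothing). We reuse `List.Vector` with its `Fintype` instance
(`Mathlib.Data.Fintype.Vector`), `Finset.card`/`Finset.univ.filter`, `Polynomial.eval`,
`Computability.encodeNat`, and the H21 notions `P`, `NP`, `PP`, `pMajority`, `PRel`, `FPRel`,
`Oracle.ofFun`, `boolPair`.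

## Design notes

* Witnesses are counted among strings of the *exact* length `m = p |x|` (as in Arora–Barak,
  Def. 17.2), matching the coin-string convention of `uniformProb`/`pMajority`; the `≤ p |x|`
  variant gives the same class `#P` (pad witnesses), which we do not restate.
* `countWitnesses` is `noncomputable` (classical decidability of `_ ∈ R`).
* `SharpP` values are natural numbers `List Bool → ℕ`; the string class `FP` is compared with
  `#P` through `Computability.encodeNat` only as a *whole answer string* (`Oracle.ofFun`,
  `IsSharpPHard`), never as a suffix (D7: `encodeNat 0 = []`).
* `IsSharpPHard` is Cook (polynomial-time Turing) hardness, the notion under which the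
  permanent is `#P`-complete (Valiant 1979); parsimonious/Karp-style counting reductions are
  not needed by the target statements.

## References

* L. G. Valiant, *The complexity of computing the permanent*, Theoret. Comput. Sci. 8 (1979),
  §2 (definition of `#P`, `#P`-completeness under oracle reductions).
* S. Fenner, L. Fortnow, S. Kurtz, *Gap-definable counting classes*, JCSS 48 (1994), §3
  (`GapP`, `PP` via `GapP`).
* S. Arora, B. Barak, *Computational Complexity: A Modern Approach*, CUP 2009, Def. 17.2
  (`#P`), Def. 17.5 (`FP^{#P}`, `#P`-completeness), §17.2.1 (`PP`), Thm. 17.11 (Valiant),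
  Thm. 17.14 (Toda, `PH ⊆ P^{#P}`).
* J. Gill, *Computational complexity of probabilistic Turing machines*, SIAM J. Comput. 6
  (1977), Def. 5.1 (`PP`).
-/

namespace Literature.Computability.Complexity

open _root_.Computability

/-! ### Counting witnesses, `#P`, `GapP` -/

/-- `countWitnesses R m x`: the number of strings `y ∈ {0,1}^m` (as `List.Vector Bool m`) with
`boolPair x y ∈ R`, i.e. `#{y ∈ {0,1}^m | R(x, y)}`. Classical (`Finset.card` of a filter by
membership in an arbitrary language). [Arora–Barak 2009, Def. 17.2; Valiant 1979, §2] [cite: AroraBarak2009, Def. 17.2] -/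
noncomputable def countWitnesses (R : Language Bool) (m : ℕ) (x : List Bool) : ℕ := by
  classical
  exact (Finset.univ.filter fun y : List.Vector Bool m => boolPair x y.toList ∈ R).card

/-- Valiant's class `#P`: functions `f : {0,1}* → ℕ` for which there are a polynomial-time
relation `R ∈ P` and a polynomial `p` with `f x = #{y ∈ {0,1}^{p |x|} | boolPair x y ∈ R}` for
every `x`. [Valiant 1979, §2; Arora–Barak 2009, Def. 17.2] [cite: Valiant1979, §2] -/
noncomputable def SharpP : Set (List Bool → ℕ) :=
  {f | ∃ R ∈ Classes.P, ∃ p : Polynomial ℕ, ∀ x : List Bool, f x = countWitnesses R (p.eval x.length) x}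

/-- The class `GapP` of differences of two `#P` functions:
`g ∈ GapP ↔ ∃ f₁ f₂ ∈ #P, ∀ x, g x = f₁ x - f₂ x` (in `ℤ`).
[Fenner–Fortnow–Kurtz 1994, §3; Arora–Barak 2009, §17.2.1 area] [cite: FennerFortnowKurtz1994, §3] -/
noncomputable def GapP : Set (List Bool → ℤ) :=
  {g | ∃ f₁ ∈ SharpP, ∃ f₂ ∈ SharpP, ∀ x : List Bool, g x = (f₁ x : ℤ) - (f₂ x : ℤ)}

/-! ### `P^{#P}`, `FP^{#P}`, relativised counting classes -/

/-- The class `P^{#P} = ⋃_{f ∈ #P} P^f` of languages decidable in polynomial time with a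
`#P` function oracle (queries answered in binary, `Oracle.ofFun`).
[Arora–Barak 2009, Def. 17.5 and Thm. 17.14] [cite: AroraBarak2009, Def. 17.5 and Thm. 17.14] -/
noncomputable def PSharpP : Set (Language Bool) :=
  ⋃ f ∈ SharpP, PRel (Oracle.ofFun f)

/-- The class `FP^{#P} = ⋃_{f ∈ #P} FP^f` of string functions computable in polynomial time
with a `#P` function oracle. [Arora–Barak 2009, Def. 17.5] [cite: AroraBarak2009, Def. 17.5] -/
noncomputable def FPSharpP : Set (List Bool → List Bool) :=
  ⋃ f ∈ SharpP, FPRel (Oracle.ofFun f)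

/-- `PPRel O = PP^O := pMajority (P^O)`: majority probabilistic polynomial time relative to the
oracle `O`. [Gill 1977, Def. 5.1; Baker–Gill–Solovay 1975, §1 (relativisation)] [cite: Gill1977, Def. 5.1] -/
noncomputable def PPRel (O : Oracle) : Set (Language Bool) :=
  pMajority (PRel O)

/-- `SharpPRel O = #P^O`: functions `x ↦ #{y ∈ {0,1}^{p |x|} | boolPair x y ∈ R}` with
`R ∈ P^O`. [Valiant 1979, §2; Arora–Barak 2009, Def. 17.2 with §3.4] [cite: Valiant1979, §2] -/
noncomputable def SharpPRel (O : Oracle) : Set (List Bool → ℕ) :=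
  {f | ∃ R ∈ PRel O, ∃ p : Polynomial ℕ, ∀ x : List Bool,
    f x = countWitnesses R (p.eval x.length) x}

/-! ### `#P`-hardness -/

/-- `IsSharpPHard O`: the oracle `O` is `#P`-hard under polynomial-time Turing (Cook)
reductions, i.e. every `f ∈ #P` is computable in `FP^O` (as the binary string
`encodeNat (f x)`, a whole answer, so `encodeNat 0 = []` is harmless).
[Valiant 1979, §2; Arora–Barak 2009, Def. 17.5] [cite: Valiant1979, §2] -/
def IsSharpPHard (O : Oracle) : Prop :=
  ∀ f ∈ SharpP, (encodeNat ∘ f) ∈ FPRel O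

/-- `IsSharpPHardFun f`: the function `f : {0,1}* → ℕ` is `#P`-hard, i.e. `#P ⊆ FP^f`
(`IsSharpPHard (Oracle.ofFun f)`); `f` is `#P`-complete when moreover `f ∈ #P`.
[Valiant 1979, §2; Arora–Barak 2009, Def. 17.5] [cite: Valiant1979, §2] -/
def IsSharpPHardFun (f : List Bool → ℕ) : Prop :=
  IsSharpPHard (Oracle.ofFun f)

/-! ### API -/

/-- `#P ⊆ GapP` (take `f₂ = 0`, which is in `#P` via the empty relation `∅ ∈ P`).
[Fenner–Fortnow–Kurtz 1994, §3] [cite: FennerFortnowKurtz1994, §3] -/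
def SharpP_subset_GapP : Prop :=
  ∀ {f : List Bool → ℕ} (hf : f ∈ SharpP),
    (fun x => (f x : ℤ)) ∈ GapP

/-- `PP` via `GapP`: `L ∈ PP ↔ ∃ g ∈ GapP, ∀ x, (x ∈ L ↔ 0 < g x)`
(take `g x = #acc(x) - #rej(x)`). [Fenner–Fortnow–Kurtz 1994, §3–4; Arora–Barak 2009,
§17.2.1] [cite: FennerFortnowKurtz1994, §3–4] -/
def mem_PP_iff_gapP : Prop :=
  ∀ {L : Language Bool},
    L ∈ PP ↔ ∃ g ∈ GapP, ∀ x : List Bool, x ∈ L ↔ 0 < g x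

/-- `NP ⊆ P^{#P}` (query the number of certificates and compare with `0`; certificates of
length `≤ p |x|` are padded to exact length). [Arora–Barak 2009, §17.2] [cite: AroraBarak2009, §17.2] -/
def NP_subset_PSharpP : Prop :=
  Nondeterministic.NP ⊆ PSharpP

/-- `PP ⊆ P^{#P}` (query the number of accepting coin strings and compare with `2^{p|x|-1}`).
[Arora–Barak 2009, §17.2.1; Gill 1977] [cite: AroraBarak2009, §17.2.1] -/
def PP_subset_PSharpP : Prop :=
  PP ⊆ PSharpP

/-- Every `#P` function is in `FP^{#P}` (as a binary string): query the oracle `f` on the input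
itself. [Arora–Barak 2009, Def. 17.5] [cite: AroraBarak2009, Def. 17.5] -/
def sharpP_mem_FPSharpP : Prop :=
  ∀ {f : List Bool → ℕ} (hf : f ∈ SharpP),
    (encodeNat ∘ f) ∈ FPSharpP

/-- `P ⊆ P^{#P}` (`#P` is nonempty and `P ⊆ P^O` for every oracle).
[Arora–Barak 2009, §17.2] [cite: AroraBarak2009, §17.2] -/
def P_subset_PSharpP : Prop :=
  Classes.P ⊆ PSharpP

/-- Unfolding lemma for `PPRel`: `PP^O = pMajority (P^O)` (definitional). [Gill 1977, Def. 5.1] [cite: Gill1977, Def. 5.1] -/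
theorem PPRel_eq (O : Oracle) : PPRel O = pMajority (PRel O) :=
  rfl

/-- Unfolding lemma for `IsSharpPHardFun` (definitional). [Arora–Barak 2009, Def. 17.5] [cite: AroraBarak2009, Def. 17.5] -/
theorem isSharpPHardFun_iff {f : List Bool → ℕ} :
    IsSharpPHardFun f ↔ ∀ g ∈ SharpP, (encodeNat ∘ g) ∈ FPRel (Oracle.ofFun f) :=
  Iff.rfl

end Literature.Computability.Complexity
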